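import Summits.CriticalPhenomena.PercolationContinuityZ3.Theorems.PercNearOneGluingNoHeavyLowerTailThreePointTransplantDictionary
import HarnessLib

/-!
# The ORBIT PRINCIPLE for two-copy percolation inequalities (Sahi programme, prover prim-sahi-p2 gen 52)

Support file (`--supports stmt-CriticalPhenomena-4575`, helper), continuing `…ThreePointTransplantDictionary` (the dictionary principle,
this gen) and `…ThreePointTransplantRecipes` (the transplant bijections).  Standard axioms, no sorries, no named facts, no definitions.
Memo `run/shared/lean/prim/prim-sahi/FROM-prim-sahi-p2-gen52-TRANSPLANT-DICTIONARY.md` §6, `prim-sahi-p2/PROOF-E3.md` (62f).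

THE PRINCIPLE.  Let a finite family of maps `f i` of `Ω × Ω` (`Ω = BondConfig V`) preserve the two-copy weight `w(θ₁)·w(θ₂)` — e.g. the
transplant recipes (`TransplantRecipes.wt2_recipe`).  The weight is then constant on the classes of the equivalence relation generated by
`θ ~ f i θ` (the ORBITS of the generated permutation group when the maps are bijections), so a two-copy inequality
`P²(A) ≤ c · P²(T)` follows from the purely COMBINATORIAL statement `#(O ∩ A) ≤ c · #(O ∩ T)` for every class `O` — no weights, no Hall
condition, no bound on word lengths.
* `wt_eq_of_eqvGen` — weight constancy along the generated equivalence relation. [folklore]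
* **`sum_le_of_classCount`** — the abstract principle: class-wise counting with a class-constant nonnegative weight. [folklore]
* **`halving_of_orbitCounts`** [this work] — for the HALVING LEMMA: if in every class `O` of the relation generated by a weight-preserving
  family, `#(O ∩ (U × D)) ≤ c · #(O ∩ (X × Ω))` (`U = {a↔s} ∪ {a↔c}`, `D = {s↮c}`, `X = U ∩ D`), then `μ(U)·μ(D) ≤ c·μ(U ∩ D)` for the
  given weights.  With `c = 3/2` this is gen 44's SHARP halving inequality `2·μ(U)μ(D) ≤ 3·μ(U∩D)`; with `c = 2` the halving lemma (v).
* **`core_of_orbitCounts`** [this work] — the same for the core: per-class `#(O ∩ (J × S0)) ≤ c · #(O ∩ (X × Ω))` gives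
  `μ(sac)·μ(s|a|c) ≤ c·μ(X)` (feed `TransplantDictionary.halving_const_of_core` / `dichotomy_of_core`).
CONJECTURE ORB (NOT asserted; exact orbit enumeration by union–find over `4^m` pairs, kit j337692 / j337926 / j337888: 2 196 graphs and
markings with ≤ 12 pairs — Petersen-free but incl. K₅, W₅, prism, K₃₃ markings, 1 500 random multigraphs, tree+chord graphs — plus the two
13/14-pair graphs on which two-letter words fail, 6.3·10⁷ orbits): for the group generated by the 24 transplant recipes, EVERY orbit `O`
satisfies `2·#(O ∩ U×D) ≤ 3·#(O ∩ X×Ω)` and `4·#(O ∩ J×S0) ≤ 3·#(O ∩ ((X×Ω) ∪ (Ω×X)))`, with equality exactly on the 'claw' orbits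
(type-1 minor `K_{1,3} + sc`); by `halving_of_orbitCounts` the first would give `2μ(U)μ(D) ≤ 3μ(U∩D)` on every finite weighted graph.
[cite: Gladkov2024, Lemma 3.1 (hybrids), Thm 1.3]; [folklore] (orbit counting / switching arguments).
-/

noncomputable section

open Classical

namespace Summit.CriticalPhenomena.PercolationContinuityZ3.Theorems

namespace TransplantOrbits

open MeasureTheory Finset
open Literature.Probability.Percolation Literature.Probability.LatticeModels
open Literature.Probability.Percolation.BHK2006 (weight weight_nonneg)
open Literature.Probability.Percolation.DecisionTree (ind ind_of_mem ind_of_not_mem ind_nonneg)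
open TransplantDictionary (sum_weight_eq_one real_mul_real_eq_sum_wt2)

/-! ### 1. Abstract orbit counting -/

/-- Weight constancy along the equivalence relation generated by weight-preserving steps. [folklore] -/
theorem wt_eq_of_eqvGen {α : Type*} (wt : α → ℝ) (r : α → α → Prop) (hr : ∀ x y, r x y → wt x = wt y) {x y : α}
    (h : Relation.EqvGen r x y) : wt x = wt y := by
  induction h with
  | rel x y hxy => exact hr x y hxy
  | refl x => rfl
  | symm x y _ ih => exact ih.symm
  | trans x y z _ _ ih1 ih2 => exact ih1.trans ih2

/-- The equivalence closure is idempotent. [folklore] -/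
theorem eqvGen_idem {α : Type*} {r : α → α → Prop} {x y : α} (h : Relation.EqvGen (Relation.EqvGen r) x y) :
    Relation.EqvGen r x y := by
  induction h with
  | rel a b hab => exact hab
  | refl a => exact Relation.EqvGen.refl a
  | symm a b _ ih => exact Relation.EqvGen.symm _ _ ih
  | trans a b d _ _ ih1 ih2 => exact Relation.EqvGen.trans _ _ _ ih1 ih2

/-- **ORBIT COUNTING PRINCIPLE.**  If a nonnegative weight is constant on the classes of a labelling `cls`, and in every class the points of `A`
are at most `c` times as many as the points of `T`, then `Σ_A wt ≤ c · Σ_T wt`. [folklore] -/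
theorem sum_le_of_classCount {α κ : Type*} (wt : α → ℝ) (hwt : ∀ x, 0 ≤ wt x) (cls : α → κ)
    (hcls : ∀ x y, cls x = cls y → wt x = wt y) (A T : Finset α) {c : ℝ} (hc : 0 ≤ c)
    (hcount : ∀ k, (((A.filter fun x => cls x = k).card : ℕ) : ℝ) ≤ c * ((T.filter fun y => cls y = k).card : ℕ)) :
    ∑ x ∈ A, wt x ≤ c * ∑ y ∈ T, wt y := by
  classical
  set L : Finset κ := (A ∪ T).image cls with hL
  have hA : ∑ x ∈ A, wt x = ∑ k ∈ L, ∑ x ∈ A.filter (fun x => cls x = k), wt x :=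
    (Finset.sum_fiberwise_of_maps_to (fun x hx => Finset.mem_image_of_mem cls (Finset.mem_union_left _ hx)) _).symm
  have hT : ∑ y ∈ T, wt y = ∑ k ∈ L, ∑ y ∈ T.filter (fun y => cls y = k), wt y :=
    (Finset.sum_fiberwise_of_maps_to (fun y hy => Finset.mem_image_of_mem cls (Finset.mem_union_right _ hy)) _).symm
  rw [hA, hT, Finset.mul_sum]
  refine Finset.sum_le_sum fun k _ => ?_
  by_cases hne : (A.filter fun x => cls x = k).Nonempty
  · obtain ⟨x₀, hx₀⟩ := hne
    have hk₀ : cls x₀ = k := (Finset.mem_filter.1 hx₀).2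
    have eA : ∑ x ∈ A.filter (fun x => cls x = k), wt x = ((A.filter fun x => cls x = k).card : ℕ) * wt x₀ := by
      rw [Finset.sum_congr rfl fun x hx => hcls x x₀ ((Finset.mem_filter.1 hx).2.trans hk₀.symm), Finset.sum_const, nsmul_eq_mul]
    have eT : ∑ y ∈ T.filter (fun y => cls y = k), wt y = ((T.filter fun y => cls y = k).card : ℕ) * wt x₀ := by
      rw [Finset.sum_congr rfl fun y hy => hcls y x₀ ((Finset.mem_filter.1 hy).2.trans hk₀.symm), Finset.sum_const, nsmul_eq_mul]
    rw [eA, eT, ← mul_assoc]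
    exact mul_le_mul_of_nonneg_right (hcount k) (hwt x₀)
  · rw [Finset.not_nonempty_iff_eq_empty.1 hne, Finset.sum_empty]
    exact mul_nonneg hc (Finset.sum_nonneg fun y _ => hwt y)

/-! ### 2. Two-copy percolation: orbit counts of a weight-preserving family -/

variable {V : Type*} [Fintype V]

/-- The two-copy weight is constant on the classes of the equivalence relation generated by a weight-preserving family of maps. [folklore] -/
theorem wt2_eq_of_orbit (w : Sym2 V → ℝ) {ι : Type*} (W : Finset ι)
    (f : ι → BondConfig V × BondConfig V → BondConfig V × BondConfig V)
    (hwf : ∀ i ∈ W, ∀ θ, weight w (f i θ).1 * weight w (f i θ).2 = weight w θ.1 * weight w θ.2)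
    {θ η : BondConfig V × BondConfig V}
    (h : Relation.EqvGen (fun x y => ∃ i ∈ W, y = f i x) θ η) :
    weight w θ.1 * weight w θ.2 = weight w η.1 * weight w η.2 := by
  refine wt_eq_of_eqvGen (fun θ : BondConfig V × BondConfig V => weight w θ.1 * weight w θ.2) _ ?_ h
  rintro x y ⟨i, hi, rfl⟩
  exact (hwf i hi x).symm

/-- `Σ_{θ} w(θ₁)w(θ₂)·1_A(θ₁) = μ(A)`: summing the two-copy weight against a first-copy event. [folklore] -/
theorem sum_wt2_ind_fst (w : Sym2 V → unitInterval) (A : Set (BondConfig V)) :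
    ∑ θ : BondConfig V × BondConfig V, weight (fun e => (w e : ℝ)) θ.1 * weight (fun e => (w e : ℝ)) θ.2 * ind A θ.1 =
      (prodBernoulli w).real A := by
  have h := real_mul_real_eq_sum_wt2 w A (Set.univ : Set (BondConfig V))
  rw [probReal_univ, mul_one] at h
  rw [h]
  refine Finset.sum_congr rfl fun θ _ => ?_
  rw [ind_of_mem (Set.mem_univ _), mul_one]

/-- **Two-copy inequalities from orbit counts.**  Let the finite family `f i` preserve the two-copy weight and let `~` be the equivalence
relation it generates on `Ω × Ω`.  If for every class `O`, `#(O ∩ (A × B)) ≤ c·#(O ∩ (T × Ω))`, then `μ(A)·μ(B) ≤ c·μ(T)`. [this work] -/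
theorem real_mul_real_le_of_orbitCounts (w : Sym2 V → unitInterval) (A B T : Set (BondConfig V)) {ι : Type*} (W : Finset ι)
    (f : ι → BondConfig V × BondConfig V → BondConfig V × BondConfig V)
    (hwf : ∀ i ∈ W, ∀ θ, weight (fun e => (w e : ℝ)) (f i θ).1 * weight (fun e => (w e : ℝ)) (f i θ).2 =
        weight (fun e => (w e : ℝ)) θ.1 * weight (fun e => (w e : ℝ)) θ.2)
    {c : ℝ} (hc : 0 ≤ c)
    (hcount : ∀ O : Quot (Relation.EqvGen (fun x y : BondConfig V × BondConfig V => ∃ i ∈ W, y = f i x)),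
      ((((Finset.univ.filter fun θ : BondConfig V × BondConfig V => θ.1 ∈ A ∧ θ.2 ∈ B).filter
          fun θ => Quot.mk _ θ = O).card : ℕ) : ℝ) ≤
        c * (((Finset.univ.filter fun θ : BondConfig V × BondConfig V => θ.1 ∈ T).filter fun θ => Quot.mk _ θ = O).card : ℕ)) :
    (prodBernoulli w).real A * (prodBernoulli w).real B ≤ c * (prodBernoulli w).real T := by
  classical
  set wt : BondConfig V × BondConfig V → ℝ := fun θ => weight (fun e => (w e : ℝ)) θ.1 * weight (fun e => (w e : ℝ)) θ.2 with hwt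
  have hw0 : ∀ e, 0 ≤ ((w e : unitInterval) : ℝ) := fun e => (w e).2.1
  have hw1 : ∀ e, ((w e : unitInterval) : ℝ) ≤ 1 := fun e => (w e).2.2
  have hwt0 : ∀ θ, 0 ≤ wt θ := fun θ => mul_nonneg (weight_nonneg hw0 hw1 _) (weight_nonneg hw0 hw1 _)
  set r := Relation.EqvGen (fun x y : BondConfig V × BondConfig V => ∃ i ∈ W, y = f i x) with hr
  set cls : BondConfig V × BondConfig V → Quot r := fun θ => Quot.mk _ θ with hcls_def
  have hcls : ∀ x y, cls x = cls y → wt x = wt y := by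
    intro x y hxy
    have hxy' : Relation.EqvGen (fun x y : BondConfig V × BondConfig V => ∃ i ∈ W, y = f i x) x y :=
      eqvGen_idem (Quot.eqvGen_exact hxy)
    exact wt2_eq_of_orbit (fun e => (w e : ℝ)) W f hwf hxy'
  set SA : Finset (BondConfig V × BondConfig V) := Finset.univ.filter fun θ => θ.1 ∈ A ∧ θ.2 ∈ B with hSA
  set ST : Finset (BondConfig V × BondConfig V) := Finset.univ.filter fun θ => θ.1 ∈ T with hST
  have hmain := sum_le_of_classCount wt hwt0 cls hcls SA ST hc hcount
  have hL : (prodBernoulli w).real A * (prodBernoulli w).real B = ∑ θ ∈ SA, wt θ := by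
    rw [real_mul_real_eq_sum_wt2, hSA, Finset.sum_filter]
    refine Finset.sum_congr rfl fun θ _ => ?_
    by_cases h1 : θ.1 ∈ A <;> by_cases h2 : θ.2 ∈ B <;> simp [ind_of_mem, ind_of_not_mem, h1, h2, hwt]
  have hR : ∑ θ ∈ ST, wt θ = (prodBernoulli w).real T := by
    rw [← sum_wt2_ind_fst w T, hST, Finset.sum_filter]
    refine Finset.sum_congr rfl fun θ _ => ?_
    by_cases h1 : θ.1 ∈ T <;> simp [ind_of_mem, ind_of_not_mem, h1, hwt]
  rw [hL, ← hR]
  exact hmain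

/-- **THE HALVING LEMMA FROM ORBIT COUNTS.**  If a weight-preserving finite family of maps of `Ω × Ω` (e.g. transplant recipes) has, in every
class `O` of the equivalence relation it generates, `#(O ∩ (U × D)) ≤ c·#(O ∩ (X × Ω))` with `U = {a↔s} ∪ {a↔c}`, `D = {s↮c}`,
`X = U ∩ D`, then `μ(U)·μ(D) ≤ c·μ(U ∩ D)`.  (`c = 3/2`: the sharp halving inequality of gen 44; `c = 2`: the halving lemma (v).) [this work] -/
theorem halving_of_orbitCounts (w : Sym2 V → unitInterval) (s a c : V) {ι : Type*} (W : Finset ι)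
    (f : ι → BondConfig V × BondConfig V → BondConfig V × BondConfig V)
    (hwf : ∀ i ∈ W, ∀ θ, weight (fun e => (w e : ℝ)) (f i θ).1 * weight (fun e => (w e : ℝ)) (f i θ).2 =
        weight (fun e => (w e : ℝ)) θ.1 * weight (fun e => (w e : ℝ)) θ.2)
    {κ : ℝ} (hκ : 0 ≤ κ)
    (hcount : ∀ O : Quot (Relation.EqvGen (fun x y : BondConfig V × BondConfig V => ∃ i ∈ W, y = f i x)),
      ((((Finset.univ.filter fun θ : BondConfig V × BondConfig V =>
            θ.1 ∈ (openConn s a ∪ openConn c a : Set (BondConfig V)) ∧ θ.2 ∈ ((openConn s c)ᶜ : Set (BondConfig V))).filter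
          fun θ => Quot.mk _ θ = O).card : ℕ) : ℝ) ≤
        κ * (((Finset.univ.filter fun θ : BondConfig V × BondConfig V =>
            θ.1 ∈ ((openConn s a ∪ openConn c a) ∩ (openConn s c)ᶜ : Set (BondConfig V))).filter fun θ => Quot.mk _ θ = O).card : ℕ)) :
    (prodBernoulli w).real (openConn s a ∪ openConn c a : Set (BondConfig V)) *
        (prodBernoulli w).real ((openConn s c)ᶜ : Set (BondConfig V)) ≤
      κ * (prodBernoulli w).real ((openConn s a ∪ openConn c a) ∩ (openConn s c)ᶜ : Set (BondConfig V)) := by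
  refine real_mul_real_le_of_orbitCounts w _ _ _ W f hwf hκ fun O => ?_
  convert hcount O

/-- **THE CORE FROM ORBIT COUNTS.**  Same with `A × B = J × S0` (`J = sac`, `S0 = s|a|c`) and target `X × Ω`,
`X = sa|c ∪ ac|s`: per-class `#(O ∩ J×S0) ≤ c·#(O ∩ X×Ω)` gives `μ(sac)·μ(s|a|c) ≤ c·μ(X)`
(then `TransplantDictionary.halving_const_of_core`, `dichotomy_of_core`). [this work] -/
theorem core_of_orbitCounts (w : Sym2 V → unitInterval) (s a c : V) {ι : Type*} (W : Finset ι)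
    (f : ι → BondConfig V × BondConfig V → BondConfig V × BondConfig V)
    (hwf : ∀ i ∈ W, ∀ θ, weight (fun e => (w e : ℝ)) (f i θ).1 * weight (fun e => (w e : ℝ)) (f i θ).2 =
        weight (fun e => (w e : ℝ)) θ.1 * weight (fun e => (w e : ℝ)) θ.2)
    {κ : ℝ} (hκ : 0 ≤ κ)
    (hcount : ∀ O : Quot (Relation.EqvGen (fun x y : BondConfig V × BondConfig V => ∃ i ∈ W, y = f i x)),
      ((((Finset.univ.filter fun θ : BondConfig V × BondConfig V =>
            θ.1 ∈ (openConn s a ∩ openConn s c : Set (BondConfig V)) ∧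
            θ.2 ∈ ((openConn s a)ᶜ ∩ (openConn s c)ᶜ ∩ (openConn a c)ᶜ : Set (BondConfig V))).filter
          fun θ => Quot.mk _ θ = O).card : ℕ) : ℝ) ≤
        κ * (((Finset.univ.filter fun θ : BondConfig V × BondConfig V =>
            θ.1 ∈ ((openConn s a ∩ (openConn s c)ᶜ) ∪ (openConn c a ∩ (openConn c s)ᶜ) : Set (BondConfig V))).filter
              fun θ => Quot.mk _ θ = O).card : ℕ)) :
    (prodBernoulli w).real (openConn s a ∩ openConn s c : Set (BondConfig V)) *
        (prodBernoulli w).real ((openConn s a)ᶜ ∩ (openConn s c)ᶜ ∩ (openConn a c)ᶜ : Set (BondConfig V)) ≤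
      κ * (prodBernoulli w).real ((openConn s a ∩ (openConn s c)ᶜ) ∪ (openConn c a ∩ (openConn c s)ᶜ) : Set (BondConfig V)) := by
  refine real_mul_real_le_of_orbitCounts w _ _ _ W f hwf hκ fun O => ?_
  convert hcount O

end TransplantOrbits

end Summit.CriticalPhenomena.PercolationContinuityZ3.Theorems

end
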